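import Summits.QuantumFields.BalabanUV.Beta.ResolventBoxCertificateNorms

/-!
# Beta / ResolventBlockCertificate — the two GENERIC items of the L-CF engine's certificate shape in the kernel: «S₈ ≥ S_∞» (Schatten-type
# majorants of the Euclidean operator norm) and «norm2x2» (the operator norm of a 2 × 2 block matrix from its four block norms), and the
# BLOCK-CURRENCY LEAF of the box certificate (β sub-cell, BINDER-OWNERS row CAP-k, lineage `b2b-balaban-beta-an5`, gen 24; node
# BETA-an5-g24-REFLECT-BLOCK, leaf 2; journal CLAIM l.15743; answers beta-cap-ref #84 R84-b «which of the two sockets an5's row types»)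

WHY.  cap1-g10's L-CF implementation #2 (journal l.15269, README-LCF2 v1.1 §8–§10) would emit per box `{centre c, h, order N; P_K or (r_K, ‖P_K‖);
block bounds; b ≤ B}` and names its Lean socket «TM arithmetic soundness + (1+E)⁻¹ Neumann + S8 ≥ S∞ + norm2x2».  Of these four items:
* «Neumann» — the a-posteriori polynomial inverse `‖T⁻¹‖ ≤ ‖P‖/(1 − r)`, `r := sup_box ‖P T − 1‖ < 1` — IS gen 23's
  `ResolventBoxCertificateTaylor.box_certificate_of_residual` (pointwise Krawczyk with a `q`-dependent preconditioner), applied to whatever square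
  family the engine inverts (the 4 × 4 capacitance block `𝒦̃`, `Q₀`, …): nothing new is needed;
* «TM arithmetic soundness» — that a Taylor-model evaluation over the box encloses the range of a polynomial/analytic expression — is the ENGINES'
  arithmetic (two independent implementations, cap-ref's width rule), entering every kernel leaf as a SUP-HYPOTHESIS over the box (`∀ q ∈ Box c h,
  ‖…‖ ≤ number`), exactly like `θ₀`/`ε`/`p` of the order-0 and order-m leaves; the kernel does not re-run 1e9 flops per box and does not claim to;
* «S8 ≥ S∞» — §1 below: `‖M‖⁴ ≤ Σ_{ij}|(MᴴM)_{ij}|²` (S₄), `‖M‖⁸ ≤ Σ_{ij}|((MᴴM)²)_{ij}|²` (S₈ — cap1's `‖W‖_{S8}⁸ = Σ_{ij}|(G²)_{ij}|²`, `G = W^*W`,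
  literally), and `‖M‖^{2^{k+2}} ≤ Σ_{ij}|((MᴴM)^{2^k})_{ij}|²` in general (C⋆-identity `‖MᴴM‖ = ‖M‖²` iterated on the Hermitian `MᴴM` +
  gen 23's `l2_opNorm_le_frobenius`); all phase-free polynomial expressions in the entries — what a Taylor-model engine bounds;
* «norm2x2» — §2 below: `‖fromBlocks A B C D‖₂ ≤ t` whenever the 2 × 2 Gram of the block-norm bounds `(a b; c e)` has top eigenvalue `≤ t²`,
  stated SQRT-FREE as `a² + c² ≤ t²`, `b² + e² ≤ t²`, `(ab + ce)² ≤ (t² − a² − c²)(t² − b² − e²)` (checkable in exact rational arithmetic);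
  corollary `‖fromBlocks A B C D‖₂ ≤ √(a² + b² + c² + e²)`.
§4 (v1.1, append-only): `l2_opNorm_submatrix_equiv` (‖M.submatrix e f‖ = ‖M‖ for equivalences) and `box_certificate_of_blocks_reindex` —
the block leaf for ANY index type through an equivalence `v ⊕ w ≃ n`.  §5 (v1.2, append-only): the Gram ∕ product form of S₈,
`l2_opNorm_mul_pow_eight_le_re_trace` (`‖AB‖⁸ ≤ Re tr(((AᴴA)(BBᴴ))⁴)` — cap1-g10's (G3) second clause literally).
§3 THE BLOCK-CURRENCY LEAF `box_certificate_of_blocks`: on a box, a RIGHT-INVERSE IDENTITY `A q · fromBlocks (G q) (X q) (Y q) (Z q) = 1` + sup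
bounds of the four blocks + the norm2x2 criterion for `B` ⟹ `IsUnit (A q).det ∧ ‖(A q)⁻¹‖ ≤ B` — the SAME per-leaf conclusion
`ResolventBoxCertificate.of_cover` ∕ `hBa_of_boxes_negConjRegion` ∕ `TubeZeroFreeSymmetry.det_ne_zero_vertexTori_of_boxes_negConjRegion` ∕
`CapRouteABoxes.rowsOfOneLoopFormCode16E_routeA₂_ofBoxesRealShift` consume.  WHAT IS NOT HERE: the block IDENTITY itself for the cell's `k₀`
(cap3's E1′ frame-free closed form `k₀⁻¹ = [[G_vv, X],[Y, Z]]`, cap1 README §2, validated there in floats to 1.4e-14) is NOT typed in the tree and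
enters this leaf as the hypothesis `hG`; what IS typed is cap3-g10's Woodbury split `CapacitanceSplit.inv_add_eq_woodburyPT` (W1) with the norm
composition `CapRouteA.norm_inv_le_of_split_vertexTori` (census V17) — a block-currency leaf therefore reaches the row either through (W1)'s
`‖𝒜‖(1 + ‖U‖‖X‖‖V‖‖𝒜‖)` [typed] or through a typed E1′ + §2 [E1′ not on file].

ANSWER TO R84-b (the row owner's, for the record): the row's typed target consumes per leaf ONLY `IsUnit (A q).det ∧ ‖(A q)⁻¹‖ ≤ Ba` on a box and
is AGNOSTIC of the engine class; the kernel offers leaf CONSTRUCTORS for both classes on file — the order-m residual leaf on the full family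
(`box_certificate_taylor`, operator or Frobenius currency) and, with this file, the block-currency leaf with Schatten majorants for the L-CF closed
form.  Neither asserts a box size, a leaf count or a price.

HONEST FRAMING.  Kernel glue ([folklore] finite-dimensional linear algebra); no number; 0 binders instantiated; discharging `BetaPertH` would make
Bałaban's UV stability UNCONDITIONAL — NOT the continuum limit, NOT Clay.  0 `sorry`, 0 cite tags.
-/

namespace Summit.QuantumFields.BalabanUV.Beta.ResolventBoxCertificate

open Complex Set Matrix Finset WithLp
open Summit.QuantumFields.BalabanUV.Beta.GAN24.ArrowNorms (l2_opNorm_le_of_forall norm_le_of_sq_le)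
open Summit.QuantumFields.BalabanUV.Beta.GAN24.BorderedFrameInverseBlocks (norm_sq_toLp_sumElim)
open scoped Real Matrix.Norms.L2Operator InnerProductSpace ComplexConjugate

noncomputable section

/-! ## §1 Schatten-type majorants: `‖M‖^{2^{k+2}} ≤ ‖(MᴴM)^{2^k}‖_F²` -/

section Schatten

variable {m o : Type*} [Fintype m] [Fintype o] [DecidableEq o]

/-- the C⋆-identity read as `‖M‖² = ‖MᴴM‖`. [folklore] -/
theorem l2_opNorm_sq_eq_norm_conjTranspose_mul_self (M : Matrix m o ℂ) : ‖M‖ ^ 2 = ‖Mᴴ * M‖ := by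
  rw [sq, Matrix.l2_opNorm_conjTranspose_mul_self]

/-- a Hermitian matrix has `‖H·H‖ = ‖H‖²`. [folklore] -/
theorem l2_opNorm_mul_self_of_isHermitian {H : Matrix o o ℂ} (hH : H.IsHermitian) : ‖H * H‖ = ‖H‖ ^ 2 := by
  have h := Matrix.l2_opNorm_conjTranspose_mul_self H
  rw [hH.eq] at h
  rw [h, sq]

/-- … hence `‖H^{2^k}‖ = ‖H‖^{2^k}` (the C⋆-identity iterated; no spectral theory). [folklore] -/
theorem l2_opNorm_pow_two_pow_of_isHermitian {H : Matrix o o ℂ} (hH : H.IsHermitian) (k : ℕ) :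
    ‖H ^ 2 ^ k‖ = ‖H‖ ^ 2 ^ k := by
  induction k with
  | zero => simp
  | succ k ih =>
    have hk : (H ^ 2 ^ k).IsHermitian := hH.pow _
    rw [pow_succ, pow_mul, sq, l2_opNorm_mul_self_of_isHermitian hk, ih, ← pow_mul, ← pow_succ]

omit [DecidableEq o] in
/-- the Frobenius sum IS `Σ_{ij} |N_{ij}|²` = the real part of `tr(Nᴴ N)` (for the cross-reader: cap1's `tr((W^*W)⁴) = Σ_{ij}|(G²)_{ij}|²`). [folklore] -/
theorem frobSq_eq_re_trace (N : Matrix m o ℂ) : frobSq N = ((Nᴴ * N).trace).re := by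
  simp only [frobSq, Matrix.trace, Matrix.diag, Matrix.mul_apply, Matrix.conjTranspose_apply, Complex.re_sum]
  rw [Finset.sum_comm]
  refine Finset.sum_congr rfl fun j _ => Finset.sum_congr rfl fun i _ => ?_
  rw [show star (N i j) * N i j = conj (N i j) * N i j from rfl, Complex.conj_mul']
  norm_cast

/-- **S₄ ≥ S_∞**: `‖M‖⁴ ≤ Σ_{ij} |(MᴴM)_{ij}|²`. [folklore] -/
theorem l2_opNorm_pow_four_le (M : Matrix m o ℂ) : ‖M‖ ^ 4 ≤ frobSq (Mᴴ * M) := by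
  have h2 : ‖M‖ ^ 4 = ‖Mᴴ * M‖ ^ 2 := by
    rw [show (4 : ℕ) = 2 * 2 from rfl, pow_mul, l2_opNorm_sq_eq_norm_conjTranspose_mul_self]
  rw [h2]
  calc ‖Mᴴ * M‖ ^ 2 ≤ (Real.sqrt (frobSq (Mᴴ * M))) ^ 2 := by gcongr; exact l2_opNorm_le_frobenius _
    _ = frobSq (Mᴴ * M) := Real.sq_sqrt (frobSq_nonneg _)

/-- **THE GENERAL SCHATTEN MAJORANT** `‖M‖^{2^{k+2}} ≤ Σ_{ij} |((MᴴM)^{2^k})_{ij}|²` (`k = 0`: S₄; `k = 1`: S₈; `k = 2`: S₁₆). [folklore] -/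
theorem l2_opNorm_pow_le_frobSq_pow (M : Matrix m o ℂ) (k : ℕ) : ‖M‖ ^ 2 ^ (k + 2) ≤ frobSq ((Mᴴ * M) ^ 2 ^ k) := by
  have hH : (Mᴴ * M).IsHermitian := Matrix.isHermitian_conjTranspose_mul_self M
  have e1 : ‖M‖ ^ 2 ^ (k + 2) = (‖Mᴴ * M‖ ^ 2 ^ k) ^ 2 := by
    rw [show 2 ^ (k + 2) = 2 * (2 ^ k * 2) by ring, pow_mul, l2_opNorm_sq_eq_norm_conjTranspose_mul_self, pow_mul]
  have e2 : ‖Mᴴ * M‖ ^ 2 ^ k = ‖(Mᴴ * M) ^ 2 ^ k‖ := (l2_opNorm_pow_two_pow_of_isHermitian hH k).symm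
  rw [e1, e2]
  calc ‖(Mᴴ * M) ^ 2 ^ k‖ ^ 2 ≤ (Real.sqrt (frobSq ((Mᴴ * M) ^ 2 ^ k))) ^ 2 := by
        gcongr; exact l2_opNorm_le_frobenius _
    _ = frobSq ((Mᴴ * M) ^ 2 ^ k) := Real.sq_sqrt (frobSq_nonneg _)

/-- **S₈ ≥ S_∞** (cap1-g10's `‖Z‖₂ ≤ ‖W‖_{S8}/(1 − r_K)` ingredient): `‖M‖⁸ ≤ Σ_{ij} |((MᴴM)²)_{ij}|²`. [folklore] -/
theorem l2_opNorm_pow_eight_le (M : Matrix m o ℂ) : ‖M‖ ^ 8 ≤ frobSq ((Mᴴ * M) * (Mᴴ * M)) := by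
  have h := l2_opNorm_pow_le_frobSq_pow M 1
  rwa [show 2 ^ (1 + 2) = 8 from rfl, pow_one, sq] at h

/-- the certified form: `Σ_{ij} |((MᴴM)²)_{ij}|² ≤ s⁸`, `0 ≤ s` ⟹ `‖M‖ ≤ s`. [folklore] -/
theorem l2_opNorm_le_of_schatten8 (M : Matrix m o ℂ) {s : ℝ} (hs : 0 ≤ s) (h : frobSq ((Mᴴ * M) * (Mᴴ * M)) ≤ s ^ 8) :
    ‖M‖ ≤ s :=
  (pow_le_pow_iff_left₀ (norm_nonneg M) hs (by norm_num : (8 : ℕ) ≠ 0)).1 ((l2_opNorm_pow_eight_le M).trans h)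

/-- and for S₄: `Σ_{ij} |(MᴴM)_{ij}|² ≤ s⁴`, `0 ≤ s` ⟹ `‖M‖ ≤ s`. [folklore] -/
theorem l2_opNorm_le_of_schatten4 (M : Matrix m o ℂ) {s : ℝ} (hs : 0 ≤ s) (h : frobSq (Mᴴ * M) ≤ s ^ 4) : ‖M‖ ≤ s :=
  (pow_le_pow_iff_left₀ (norm_nonneg M) hs (by norm_num : (4 : ℕ) ≠ 0)).1 ((l2_opNorm_pow_four_le M).trans h)

end Schatten

/-! ## §2 «norm2x2»: the operator norm of a 2 × 2 block matrix from its four block norms -/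

section Norm2x2

variable {m o m' o' : Type*} [Fintype m] [Fintype o] [Fintype m'] [Fintype o'] [DecidableEq m'] [DecidableEq o']

/-- the elementary 2 × 2 step: `α, γ ≥ 0`, `β² ≤ α γ` ⟹ `α X² − 2 β X Y + γ Y² ≥ 0`. [folklore] -/
theorem quadForm₂_nonneg {α β γ X Y : ℝ} (hα : 0 ≤ α) (hγ : 0 ≤ γ) (hβ : β ^ 2 ≤ α * γ) :
    0 ≤ α * X ^ 2 - 2 * β * X * Y + γ * Y ^ 2 := by
  rcases eq_or_lt_of_le hα with h0 | hpos
  · have hb : β = 0 := by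
      have : β ^ 2 ≤ 0 := by rw [← h0, zero_mul] at hβ; exact hβ
      exact pow_eq_zero_iff (n := 2) (by norm_num) |>.1 (le_antisymm this (sq_nonneg β))
    rw [← h0, hb]; nlinarith [sq_nonneg Y]
  · have key : α * (α * X ^ 2 - 2 * β * X * Y + γ * Y ^ 2) = (α * X - β * Y) ^ 2 + (α * γ - β ^ 2) * Y ^ 2 := by ring
    have hnn : 0 ≤ α * (α * X ^ 2 - 2 * β * X * Y + γ * Y ^ 2) := by
      rw [key]; nlinarith [sq_nonneg (α * X - β * Y), sq_nonneg Y]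
    exact nonneg_of_mul_nonneg_right hnn hpos

/-- the 2 × 2 majorisation: if `a² + c² ≤ t²`, `b² + e² ≤ t²` and `(ab + ce)² ≤ (t² − a² − c²)(t² − b² − e²)`, then
`(aX + bY)² + (cX + eY)² ≤ t² (X² + Y²)` for all real `X, Y`. [folklore] -/
theorem norm2x2_form_le {a b c e t X Y : ℝ} (hp : a ^ 2 + c ^ 2 ≤ t ^ 2) (hq : b ^ 2 + e ^ 2 ≤ t ^ 2)
    (hr : (a * b + c * e) ^ 2 ≤ (t ^ 2 - (a ^ 2 + c ^ 2)) * (t ^ 2 - (b ^ 2 + e ^ 2))) :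
    (a * X + b * Y) ^ 2 + (c * X + e * Y) ^ 2 ≤ t ^ 2 * (X ^ 2 + Y ^ 2) := by
  have h := quadForm₂_nonneg (X := X) (Y := Y) (β := a * b + c * e) (sub_nonneg.mpr hp) (sub_nonneg.mpr hq) hr
  nlinarith [h]

/-- **norm2x2.**  For a block matrix `M = [[A, B],[C, D]]` with `‖A‖ ≤ a`, `‖B‖ ≤ b`, `‖C‖ ≤ c`, `‖D‖ ≤ e` (Euclidean operator norms) and `t ≥ 0`
satisfying the sqrt-free top-eigenvalue criterion of the 2 × 2 Gram `[[a² + c², ab + ce],[ab + ce, b² + e²]] ≤ t²` —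
`a² + c² ≤ t²`, `b² + e² ≤ t²`, `(ab + ce)² ≤ (t² − a² − c²)(t² − b² − e²)` — one has `‖M‖ ≤ t`. [folklore] -/
theorem l2_opNorm_fromBlocks_le (A : Matrix m m' ℂ) (B : Matrix m o' ℂ) (C : Matrix o m' ℂ) (D : Matrix o o' ℂ)
    {a b c e t : ℝ} (ha : ‖A‖ ≤ a) (hb : ‖B‖ ≤ b) (hc : ‖C‖ ≤ c) (he : ‖D‖ ≤ e) (ht : 0 ≤ t)
    (hp : a ^ 2 + c ^ 2 ≤ t ^ 2) (hq : b ^ 2 + e ^ 2 ≤ t ^ 2)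
    (hr : (a * b + c * e) ^ 2 ≤ (t ^ 2 - (a ^ 2 + c ^ 2)) * (t ^ 2 - (b ^ 2 + e ^ 2))) :
    ‖fromBlocks A B C D‖ ≤ t := by
  have ha0 : 0 ≤ a := (norm_nonneg _).trans ha
  have hb0 : 0 ≤ b := (norm_nonneg _).trans hb
  have hc0 : 0 ≤ c := (norm_nonneg _).trans hc
  have he0 : 0 ≤ e := (norm_nonneg _).trans he
  refine l2_opNorm_le_of_forall _ ht fun z => norm_le_of_sq_le _ (mul_nonneg ht (norm_nonneg _)) ?_
  set x : EuclideanSpace ℂ m' := toLp 2 (ofLp z ∘ Sum.inl) with hx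
  set y : EuclideanSpace ℂ o' := toLp 2 (ofLp z ∘ Sum.inr) with hy
  have hz : ofLp z = Sum.elim (ofLp x) (ofLp y) := by rw [hx, hy, ofLp_toLp, ofLp_toLp, Sum.elim_comp_inl_inr]
  have hz2 : ‖z‖ ^ 2 = ‖x‖ ^ 2 + ‖y‖ ^ 2 := by
    have h := norm_sq_toLp_sumElim (ofLp x) (ofLp y)
    rwa [← hz, toLp_ofLp, toLp_ofLp, toLp_ofLp] at h
  have h1 : ‖(toLp 2 (A *ᵥ ofLp x + B *ᵥ ofLp y) : EuclideanSpace ℂ m)‖ ≤ a * ‖x‖ + b * ‖y‖ := by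
    rw [toLp_add]
    refine (norm_add_le _ _).trans (add_le_add ?_ ?_)
    · exact (Matrix.l2_opNorm_mulVec A x).trans (mul_le_mul_of_nonneg_right ha (norm_nonneg _))
    · exact (Matrix.l2_opNorm_mulVec B y).trans (mul_le_mul_of_nonneg_right hb (norm_nonneg _))
  have h2 : ‖(toLp 2 (C *ᵥ ofLp x + D *ᵥ ofLp y) : EuclideanSpace ℂ o)‖ ≤ c * ‖x‖ + e * ‖y‖ := by
    rw [toLp_add]
    refine (norm_add_le _ _).trans (add_le_add ?_ ?_)
    · exact (Matrix.l2_opNorm_mulVec C x).trans (mul_le_mul_of_nonneg_right hc (norm_nonneg _))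
    · exact (Matrix.l2_opNorm_mulVec D y).trans (mul_le_mul_of_nonneg_right he (norm_nonneg _))
  have hM : ‖(toLp 2 (fromBlocks A B C D *ᵥ ofLp z) : EuclideanSpace ℂ (m ⊕ o))‖ ^ 2
      = ‖(toLp 2 (A *ᵥ ofLp x + B *ᵥ ofLp y) : EuclideanSpace ℂ m)‖ ^ 2
        + ‖(toLp 2 (C *ᵥ ofLp x + D *ᵥ ofLp y) : EuclideanSpace ℂ o)‖ ^ 2 := by
    rw [hz, fromBlocks_mulVec, norm_sq_toLp_sumElim, Sum.elim_comp_inl, Sum.elim_comp_inr]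
  change ‖(toLp 2 (fromBlocks A B C D *ᵥ ofLp z) : EuclideanSpace ℂ (m ⊕ o))‖ ^ 2 ≤ (t * ‖z‖) ^ 2
  rw [hM, mul_pow, hz2]
  have hX := norm_nonneg x
  have hY := norm_nonneg y
  have hs1 : 0 ≤ a * ‖x‖ + b * ‖y‖ := by positivity
  have hs2 : 0 ≤ c * ‖x‖ + e * ‖y‖ := by positivity
  calc ‖(toLp 2 (A *ᵥ ofLp x + B *ᵥ ofLp y) : EuclideanSpace ℂ m)‖ ^ 2
        + ‖(toLp 2 (C *ᵥ ofLp x + D *ᵥ ofLp y) : EuclideanSpace ℂ o)‖ ^ 2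
      ≤ (a * ‖x‖ + b * ‖y‖) ^ 2 + (c * ‖x‖ + e * ‖y‖) ^ 2 := by
        gcongr
    _ ≤ t ^ 2 * (‖x‖ ^ 2 + ‖y‖ ^ 2) := norm2x2_form_le hp hq hr

/-- the crude corollary `‖[[A, B],[C, D]]‖ ≤ √(a² + b² + c² + e²)` (take `t² = p + q`; the criterion holds by Cauchy–Schwarz). [folklore] -/
theorem l2_opNorm_fromBlocks_le_sqrt (A : Matrix m m' ℂ) (B : Matrix m o' ℂ) (C : Matrix o m' ℂ) (D : Matrix o o' ℂ)
    {a b c e : ℝ} (ha : ‖A‖ ≤ a) (hb : ‖B‖ ≤ b) (hc : ‖C‖ ≤ c) (he : ‖D‖ ≤ e) :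
    ‖fromBlocks A B C D‖ ≤ Real.sqrt (a ^ 2 + b ^ 2 + c ^ 2 + e ^ 2) := by
  refine l2_opNorm_fromBlocks_le A B C D ha hb hc he (Real.sqrt_nonneg _) ?_ ?_ ?_
  all_goals rw [Real.sq_sqrt (by positivity)]
  · nlinarith [sq_nonneg b, sq_nonneg e]
  · nlinarith [sq_nonneg a, sq_nonneg c]
  · nlinarith [sq_nonneg (a * e - c * b)]

end Norm2x2

/-! ## §3 The block-currency leaf of the box certificate -/

section BlockLeaf

variable {d : ℕ} {v w : Type*} [Fintype v] [Fintype w] [DecidableEq v] [DecidableEq w]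

/-- **THE BLOCK-CURRENCY LEAF.**  On a box `Box c h`: a right-inverse identity `A q · [[G q, X q],[Y q, Z q]] = 1` (the engine's closed form for
`k₀⁻¹`, TYPED — hypothesis `hG`), sup bounds `a, b, c', e` of the four blocks (any admissible currency upstream: operator norm, Frobenius
`l2_opNorm_le_of_frobSq_le`, Schatten `l2_opNorm_le_of_schatten8`, a Neumann quotient `‖P‖/(1 − r)` from `box_certificate_of_residual`, products
`Matrix.l2_opNorm_mul`), and the norm2x2 criterion for `B` ⟹ `IsUnit (A q).det ∧ ‖(A q)⁻¹‖ ≤ B` on the box. [folklore] -/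
theorem box_certificate_of_blocks {A : (Fin (d + 1) → ℂ) → Matrix (v ⊕ w) (v ⊕ w) ℂ}
    (G : (Fin (d + 1) → ℂ) → Matrix v v ℂ) (X : (Fin (d + 1) → ℂ) → Matrix v w ℂ)
    (Y : (Fin (d + 1) → ℂ) → Matrix w v ℂ) (Z : (Fin (d + 1) → ℂ) → Matrix w w ℂ)
    {c : Fin (d + 1) → ℂ} {h : Fin (d + 1) → ℝ} {a b c' e B : ℝ}
    (hG : ∀ q ∈ Box c h, A q * fromBlocks (G q) (X q) (Y q) (Z q) = 1)
    (ha : ∀ q ∈ Box c h, ‖G q‖ ≤ a) (hb : ∀ q ∈ Box c h, ‖X q‖ ≤ b) (hc : ∀ q ∈ Box c h, ‖Y q‖ ≤ c')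
    (he : ∀ q ∈ Box c h, ‖Z q‖ ≤ e) (hB : 0 ≤ B)
    (hp : a ^ 2 + c' ^ 2 ≤ B ^ 2) (hq₂ : b ^ 2 + e ^ 2 ≤ B ^ 2)
    (hr : (a * b + c' * e) ^ 2 ≤ (B ^ 2 - (a ^ 2 + c' ^ 2)) * (B ^ 2 - (b ^ 2 + e ^ 2))) :
    ∀ q ∈ Box c h, IsUnit (A q).det ∧ ‖(A q)⁻¹‖ ≤ B := fun q hq =>
  ⟨Matrix.isUnit_det_of_right_inverse (hG q hq), by
    rw [Matrix.inv_eq_right_inv (hG q hq)]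
    exact l2_opNorm_fromBlocks_le _ _ _ _ (ha q hq) (hb q hq) (hc q hq) (he q hq) hB hp hq₂ hr⟩

end BlockLeaf

/-! ## §4 (v1.1, APPEND-ONLY) Reindexing: the operator norm is invariant under relabelling, so the block leaf serves ANY index type
through an equivalence `v ⊕ w ≃ n` (the engine's variable ∕ constraint split of its index set) -/

section Reindex

open Summit.QuantumFields.BalabanUV.Beta.GAN24.ArrowNorms (norm_toLp_mulVec_le)

variable {m o m' o' : Type*} [Fintype m] [Fintype o] [Fintype m'] [Fintype o'] [DecidableEq o] [DecidableEq o']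

omit [DecidableEq o] [DecidableEq o'] in
/-- the Euclidean norm is invariant under relabelling the coordinates by an equivalence. [folklore] -/
theorem norm_toLp_comp_equiv (e : m' ≃ m) (y : m → ℂ) :
    ‖(toLp 2 (y ∘ e) : EuclideanSpace ℂ m')‖ = ‖(toLp 2 y : EuclideanSpace ℂ m)‖ := by
  have h : ‖(toLp 2 (y ∘ e) : EuclideanSpace ℂ m')‖ ^ 2 = ‖(toLp 2 y : EuclideanSpace ℂ m)‖ ^ 2 := by
    rw [EuclideanSpace.norm_sq_eq, EuclideanSpace.norm_sq_eq]
    exact e.sum_comp (fun i => ‖y i‖ ^ 2)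
  exact (pow_left_inj₀ (norm_nonneg _) (norm_nonneg _) two_ne_zero).1 h

/-- `‖M.submatrix e f‖ ≤ ‖M‖` for equivalences `e`, `f`. [folklore] -/
theorem l2_opNorm_submatrix_equiv_le (M : Matrix m o ℂ) (e : m' ≃ m) (f : o' ≃ o) : ‖M.submatrix e f‖ ≤ ‖M‖ := by
  refine l2_opNorm_le_of_forall _ (norm_nonneg _) fun x => ?_
  rw [Matrix.submatrix_mulVec_equiv, norm_toLp_comp_equiv]
  have hx : ‖(toLp 2 (ofLp x ∘ f.symm) : EuclideanSpace ℂ o)‖ = ‖x‖ := by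
    rw [norm_toLp_comp_equiv f.symm (ofLp x), toLp_ofLp]
  calc ‖(toLp 2 (M *ᵥ (ofLp x ∘ f.symm)) : EuclideanSpace ℂ m)‖ ≤ ‖M‖ * ‖(toLp 2 (ofLp x ∘ f.symm) : EuclideanSpace ℂ o)‖ :=
        norm_toLp_mulVec_le M _
    _ = ‖M‖ * ‖x‖ := by rw [hx]

/-- **REINDEXING DOES NOT CHANGE THE EUCLIDEAN OPERATOR NORM**: `‖M.submatrix e f‖ = ‖M‖` for equivalences (`Matrix.reindex` included). [folklore] -/
theorem l2_opNorm_submatrix_equiv (M : Matrix m o ℂ) (e : m' ≃ m) (f : o' ≃ o) : ‖M.submatrix e f‖ = ‖M‖ := by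
  refine le_antisymm (l2_opNorm_submatrix_equiv_le M e f) ?_
  have h := l2_opNorm_submatrix_equiv_le (M.submatrix e f) e.symm f.symm
  rwa [Matrix.submatrix_submatrix, Equiv.self_comp_symm, Equiv.self_comp_symm, Matrix.submatrix_id_id] at h

variable {d : ℕ} {n v w : Type*} [Fintype n] [Fintype v] [Fintype w] [DecidableEq n] [DecidableEq v] [DecidableEq w]

/-- **THE BLOCK-CURRENCY LEAF FOR ANY INDEX TYPE.**  With an equivalence `e : v ⊕ w ≃ n` (the split of the engine's index set into
variables and constraints), a right-inverse identity for the RELABELLED family `(A q).submatrix e e · [[G q, X q],[Y q, Z q]] = 1` on the box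
+ four block sups + the norm2x2 criterion for `B` ⟹ `IsUnit (A q).det ∧ ‖(A q)⁻¹‖ ≤ B` on the box, for the ORIGINAL family
(`Matrix.det_submatrix_equiv_self`, `Matrix.inv_submatrix_equiv`, `l2_opNorm_submatrix_equiv`). [folklore] -/
theorem box_certificate_of_blocks_reindex {A : (Fin (d + 1) → ℂ) → Matrix n n ℂ} (e : v ⊕ w ≃ n)
    (G : (Fin (d + 1) → ℂ) → Matrix v v ℂ) (X : (Fin (d + 1) → ℂ) → Matrix v w ℂ)
    (Y : (Fin (d + 1) → ℂ) → Matrix w v ℂ) (Z : (Fin (d + 1) → ℂ) → Matrix w w ℂ)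
    {c : Fin (d + 1) → ℂ} {h : Fin (d + 1) → ℝ} {a b c' e' B : ℝ}
    (hG : ∀ q ∈ Box c h, (A q).submatrix e e * fromBlocks (G q) (X q) (Y q) (Z q) = 1)
    (ha : ∀ q ∈ Box c h, ‖G q‖ ≤ a) (hb : ∀ q ∈ Box c h, ‖X q‖ ≤ b) (hc : ∀ q ∈ Box c h, ‖Y q‖ ≤ c')
    (he : ∀ q ∈ Box c h, ‖Z q‖ ≤ e') (hB : 0 ≤ B)
    (hp : a ^ 2 + c' ^ 2 ≤ B ^ 2) (hq₂ : b ^ 2 + e' ^ 2 ≤ B ^ 2)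
    (hr : (a * b + c' * e') ^ 2 ≤ (B ^ 2 - (a ^ 2 + c' ^ 2)) * (B ^ 2 - (b ^ 2 + e' ^ 2))) :
    ∀ q ∈ Box c h, IsUnit (A q).det ∧ ‖(A q)⁻¹‖ ≤ B := fun q hq => by
  obtain ⟨hU, hN⟩ :=
    box_certificate_of_blocks (A := fun q => (A q).submatrix e e) G X Y Z hG ha hb hc he hB hp hq₂ hr q hq
  refine ⟨by rwa [Matrix.det_submatrix_equiv_self] at hU, ?_⟩
  have h2 : ((A q).submatrix (⇑e) (⇑e))⁻¹ = (A q)⁻¹.submatrix e e := Matrix.inv_submatrix_equiv _ _ _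
  rw [h2, l2_opNorm_submatrix_equiv] at hN
  exact hN

end Reindex

/-! ## §5 (v1.2, APPEND-ONLY) The product form of S₈ by cyclicity: `‖A·B‖⁸ ≤ Re tr(((AᴴA)(BBᴴ))⁴)` — cap1-g10's (G3) second clause
`‖AB‖₂ ≤ (tr((A^*A)(BB^*))⁴)^{1/8}` literally (the Gram form the engine evaluates: two PSD factors, no product matrix formed) -/

section ProductForm

variable {m o l : Type*} [Fintype m] [Fintype o] [Fintype l] [DecidableEq o] [DecidableEq l]

/-- powers of `(AB)ᴴ(AB)` unrolled through the two Grams `AᴴA`, `BBᴴ`. [folklore] -/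
theorem conjTranspose_mul_self_pow_succ (A : Matrix m o ℂ) (B : Matrix o l ℂ) (k : ℕ) :
    ((A * B)ᴴ * (A * B)) ^ (k + 1) = Bᴴ * ((Aᴴ * A) * (B * Bᴴ)) ^ k * (Aᴴ * A) * B := by
  induction k with
  | zero => rw [zero_add, pow_one, pow_zero, Matrix.mul_one, Matrix.conjTranspose_mul]; simp only [Matrix.mul_assoc]
  | succ k ih =>
    rw [pow_succ, ih, Matrix.conjTranspose_mul, pow_succ]
    simp only [Matrix.mul_assoc]

/-- **CYCLICITY**: `tr(((AB)ᴴ(AB))^{k+1}) = tr(((AᴴA)(BBᴴ))^{k+1})`. [folklore] -/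
theorem trace_conjTranspose_mul_self_pow (A : Matrix m o ℂ) (B : Matrix o l ℂ) (k : ℕ) :
    (((A * B)ᴴ * (A * B)) ^ (k + 1)).trace = (((Aᴴ * A) * (B * Bᴴ)) ^ (k + 1)).trace := by
  rw [conjTranspose_mul_self_pow_succ, Matrix.mul_assoc, Matrix.mul_assoc, Matrix.trace_mul_comm, Matrix.mul_assoc, pow_succ]
  congr 1
  simp only [Matrix.mul_assoc]

omit [DecidableEq l] in
/-- for a Hermitian `N`: `Σ_{ij}|N_{ij}|² = Re tr(N²)`. [folklore] -/
theorem frobSq_eq_re_trace_sq_of_isHermitian {N : Matrix l l ℂ} (hN : N.IsHermitian) : frobSq N = ((N * N).trace).re := by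
  rw [frobSq_eq_re_trace, hN.eq]

/-- **S₈ IN GRAM FORM**: `‖A·B‖⁸ ≤ Re tr(((AᴴA)(BBᴴ))⁴)`. [folklore] -/
theorem l2_opNorm_mul_pow_eight_le_re_trace (A : Matrix m o ℂ) (B : Matrix o l ℂ) :
    ‖A * B‖ ^ 8 ≤ ((((Aᴴ * A) * (B * Bᴴ)) ^ 4).trace).re := by
  set X := (A * B)ᴴ * (A * B) with hXdef
  have hX : X.IsHermitian := Matrix.isHermitian_conjTranspose_mul_self _
  have hX2 : (X * X).IsHermitian := by simpa [sq] using hX.pow 2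
  have e1 : X ^ 4 = (X * X) * (X * X) := by rw [show (4 : ℕ) = 2 * 2 from rfl, pow_mul, sq, sq]
  have e2 : (X ^ 4).trace = (((Aᴴ * A) * (B * Bᴴ)) ^ 4).trace := trace_conjTranspose_mul_self_pow A B 3
  have h1 : ‖A * B‖ ^ 8 ≤ frobSq (X * X) := l2_opNorm_pow_eight_le (A * B)
  rw [frobSq_eq_re_trace_sq_of_isHermitian hX2, ← e1, e2] at h1
  exact h1

end ProductForm

end

end Summit.QuantumFields.BalabanUV.Beta.ResolventBoxCertificate
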